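import Mathlib
import Literature.MathematicalPhysics.KineticTheory.FouriersLaw
import Literature.MathematicalPhysics.KineticTheory.LangevinChainKernel
import Literature.MathematicalPhysics.KineticTheory.LangevinChainGibbs
import Literature.MathematicalPhysics.KineticTheory.InfiniteChainDynamics

/-!
# Sketch — crux-ideate stmt-AtomisticToContinuum-12596 (AbelThermodynamicLimit), ideator 1 (gen 2: + Karamata upgrades)

First lemmas of the idea cards (statements need only ELABORATE; `fekete_abel_upper` is PROVED, the Loomis
upgrade is stated with `sorry`).

Card `fekete-at-every-laplace-frequency`:
* `currentResolventForm` — F_N(ν) = ∫₀^∞ e^{-νt} c_N(t) dt, c_N(t) = ∫ J·(P_t J) dμ_{N,T}, for the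
  open pinned chain with both baths at T (tree objects `gibbsMeasure`, `transitionKernel`,
  `bondCurrent`), as in route StaticAbelianSqueeze.
* `QuasiSuperadditiveCurrentForm` — the SIGN LAW (QS): ν-uniform quasi-superadditivity of F_N(ν)
  under concatenation of chains.
* `fekete_abel_upper` — the real-analysis interchange lemma: QS + pointwise identification at each
  ν > 0 + the closed-chain Abel hypothesis ⇒ F_N(0⁺) ≤ N·T²κ + C for every N (hence limsup D_N ≤ κ_A).
-/

noncomputable section

open MeasureTheory Filter Topology Set
open scoped NNReal BigOperators

namespace Summit.AtomisticToContinuum.FouriersLaw.Cruxes.AbelThermodynamicLimit.FeketeAtEveryLaplaceFrequency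

open Literature.MathematicalPhysics.KineticTheory.HeatConduction

/-- Total bond current `J = Σ_b j_b` of the `N`-chain. -/
def totalCurrentObs (P : OscillatorChain) (N : ℕ) (x : PhaseSpace N) : ℝ :=
  ∑ i : Fin N, P.bondCurrent N i x

/-- Equilibrium current autocorrelation of the OPEN chain (both baths at `T`):
`c_N(t) = ∫ J(x) · (P_t J)(x) dμ_{N,T}(x)`. -/
def currentAutocorr (P : OscillatorChain) (N : ℕ) (T : ℝ) (t : ℝ) : ℝ :=
  ∫ x, totalCurrentObs P N x *
      (∫ y, totalCurrentObs P N y ∂(P.transitionKernel N T T t.toNNReal x)) ∂(P.gibbsMeasure N T)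

/-- The current resolvent form `F_N(ν) = ∫₀^∞ e^{-νt} c_N(t) dt = Re⟨J,(ν − L_N)⁻¹J⟩_{L²(μ_{N,T})}`. -/
def currentResolventForm (P : OscillatorChain) (N : ℕ) (T : ℝ) (ν : ℝ) : ℝ :=
  ∫ t in Ioi (0 : ℝ), Real.exp (-(ν * t)) * currentAutocorr P N T t

/-- **(QS) ν-uniform quasi-superadditivity of the open-chain current resolvent form** (the sign law
of card `fekete-at-every-laplace-frequency`): for the pinned anharmonic chain and every `T > 0` there
are `C ≥ 0` and `ν₀ > 0` such that concatenating an `N`-chain and an `M`-chain (removing the two inner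
Langevin contacts, adding one anharmonic bond) never lowers the Laplace-resolved current noise by
more than `C`, uniformly in the Laplace frequency `ν ∈ (0, ν₀]`. -/
def QuasiSuperadditiveCurrentForm : Prop :=
  ∀ ω₂ lam β γ : ℝ, 0 < ω₂ → 0 < lam → 0 < β → 0 < γ → ∀ T : ℝ, 0 < T →
    ∃ C ν₀ : ℝ, 0 ≤ C ∧ 0 < ν₀ ∧ ∀ ν ∈ Ioc (0 : ℝ) ν₀, ∀ N M : ℕ, 2 ≤ N → 2 ≤ M →
      currentResolventForm (pinnedChain ω₂ lam β γ) N T ν +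
          currentResolventForm (pinnedChain ω₂ lam β γ) M T ν - C ≤
        currentResolventForm (pinnedChain ω₂ lam β γ) (N + M) T ν

/-- **Fekete at every Laplace frequency ⇒ the upper half of the thermodynamic limit.**
Pure real analysis: if `F N ν` is quasi-superadditive in `N` uniformly in `ν ∈ (0, ν₀]` (QS), if
for each such `ν` the per-length limit `F N ν / N → K ν` holds (the Abelian squeeze), if `K ν → L` as
`ν ↓ 0` (the closed-chain Abel witness, `L = T²κ`), and if `F N` has a right limit `F0 N` at `ν = 0`
(finite-`N` Kubo–Abel identity: `F0 N = (N-1)T² D_N`), then `F0 N ≤ N·L + C` for every `N ≥ 2`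
(Fekete: a superadditive sequence sits below its limit), whence `limsup_N D_N ≤ κ`. -/
theorem fekete_abel_upper (F : ℕ → ℝ → ℝ) (F0 : ℕ → ℝ) (K : ℝ → ℝ) (C L ν₀ : ℝ) (hν₀ : 0 < ν₀)
    (hQS : ∀ ν ∈ Ioc (0 : ℝ) ν₀, ∀ N M : ℕ, 2 ≤ N → 2 ≤ M → F N ν + F M ν - C ≤ F (N + M) ν)
    (hlim : ∀ ν ∈ Ioc (0 : ℝ) ν₀, Tendsto (fun N : ℕ => F N ν / N) atTop (𝓝 (K ν)))
    (hK : Tendsto K (𝓝[>] 0) (𝓝 L))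
    (hDC : ∀ N : ℕ, 2 ≤ N → Tendsto (F N) (𝓝[>] 0) (𝓝 (F0 N))) :
    ∀ N : ℕ, 2 ≤ N → F0 N ≤ N * L + C := by
  intro N hN
  have hNpos : 0 < N := by omega
  have hNposR : (0 : ℝ) < N := by exact_mod_cast hNpos
  -- Step 1: at every admissible Laplace frequency the finite chain sits below the per-length limit.
  have key : ∀ ν ∈ Ioc (0 : ℝ) ν₀, F N ν ≤ N * K ν + C := by
    intro ν hν
    -- iterated quasi-superadditivity: k·F_N − (k−1)·C ≤ F_{kN}
    have iter : ∀ k : ℕ, 1 ≤ k → (k : ℝ) * F N ν - ((k : ℝ) - 1) * C ≤ F (k * N) ν := by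
      intro k hk
      induction k with
      | zero => omega
      | succ k ih =>
        rcases Nat.eq_zero_or_pos k with rfl | hkpos
        · simp
        · have ih' := ih hkpos
          have hkN : 2 ≤ k * N := le_trans hN (Nat.le_mul_of_pos_left N hkpos)
          have hq := hQS ν hν (k * N) N hkN hN
          have hcast : ((k + 1 : ℕ) : ℝ) = (k : ℝ) + 1 := by push_cast; ring
          have hidx : (k + 1) * N = k * N + N := by ring
          rw [hidx, hcast]
          linarith
    -- along the subsequence k ↦ kN the per-length values converge to K ν
    have hmul : Tendsto (fun k : ℕ => k * N) atTop atTop :=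
      tendsto_atTop_atTop.2 fun b => ⟨b, fun k hk => le_trans hk (Nat.le_mul_of_pos_right k hNpos)⟩
    have hsub : Tendsto (fun k : ℕ => F (k * N) ν / ((k * N : ℕ) : ℝ)) atTop (𝓝 (K ν)) :=
      (hlim ν hν).comp hmul
    have hRHS : Tendsto (fun k : ℕ => (F N ν - C) / N + C / N / (k : ℝ)) atTop
        (𝓝 ((F N ν - C) / N + 0)) :=
      tendsto_const_nhds.add (tendsto_const_div_atTop_nhds_zero_nat (C / N))
    have hlow : ∀ᶠ k : ℕ in atTop,
        (F N ν - C) / N + C / N / (k : ℝ) ≤ F (k * N) ν / ((k * N : ℕ) : ℝ) := by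
      filter_upwards [eventually_ge_atTop 1] with k hk
      have hkposR : (0 : ℝ) < k := by exact_mod_cast hk
      have h := iter k hk
      have e1 : (F N ν - C) / N + C / N / (k : ℝ) =
          ((k : ℝ) * F N ν - ((k : ℝ) - 1) * C) / ((k * N : ℕ) : ℝ) := by
        push_cast
        field_simp
        ring
      rw [e1]
      exact div_le_div_of_nonneg_right h (by positivity)
    have hle : (F N ν - C) / N + 0 ≤ K ν := le_of_tendsto_of_tendsto hRHS hsub hlow
    rw [add_zero, div_le_iff₀ hNposR] at hle
    linarith
  -- Step 2: let ν ↓ 0 at fixed N through the Abel witness K ν → L.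
  have hev : ∀ᶠ ν in 𝓝[>] (0 : ℝ), F N ν ≤ N * K ν + C := by
    filter_upwards [Ioc_mem_nhdsGT hν₀] with ν hν using key ν hν
  have hlimG : Tendsto (fun ν => (N : ℝ) * K ν + C) (𝓝[>] (0 : ℝ)) (𝓝 (N * L + C)) :=
    (hK.const_mul (N : ℝ)).add_const C
  exact le_of_tendsto_of_tendsto (hDC N hN) hlimG hev

/-- The chain-level consequence targeted by the card (upper half of crux `AbelThermodynamicLimit`
plus existence of the limit): stated here over abstract response data to fix the shape. Under QS, the
squeeze and the Kubo–Abel identity, for every Abel witness value `κ` of the closed chain,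
`limsup_N D_N ≤ κ` and `(D_N)` converges. -/
def UpperHalfAndExistence : Prop :=
  ∀ ω₂ lam β γ : ℝ, 0 < ω₂ → 0 < lam → 0 < β → 0 < γ → ∀ T : ℝ, 0 < T →
    ∀ (D : ℕ → ℝ) (K : ℝ → ℝ) (κ ν₀ : ℝ), 0 < ν₀ →
      (∀ N : ℕ, 2 ≤ N → Tendsto (currentResolventForm (pinnedChain ω₂ lam β γ) N T)
          (𝓝[>] 0) (𝓝 ((N - 1) * T ^ 2 * D N))) →
      (∀ ν ∈ Ioc (0 : ℝ) ν₀, Tendsto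
          (fun N : ℕ => currentResolventForm (pinnedChain ω₂ lam β γ) N T ν / N) atTop (𝓝 (K ν))) →
      Tendsto K (𝓝[>] 0) (𝓝 (T ^ 2 * κ)) →
      (limsup (fun N => D N) atTop ≤ κ) ∧ ∃ κ' : ℝ, Tendsto D atTop (𝓝 κ')

end Summit.AtomisticToContinuum.FouriersLaw.Cruxes.AbelThermodynamicLimit.FeketeAtEveryLaplaceFrequency

/-! ## Card `loomis-compact-horizon-witness` -/

namespace Summit.AtomisticToContinuum.FouriersLaw.Cruxes.AbelThermodynamicLimit.LoomisCompactHorizonWitness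

open Literature.MathematicalPhysics.KineticTheory.HeatConduction

/-- **Loomis window upgrade** (first lemma of card `loomis-compact-horizon-witness`; pure measure
theory on `ℝ`). For a finite POSITIVE measure `σ` (the current spectral measure), the Abel/Poisson
hypothesis `∫ ν/(ν²+ω²) dσ(ω) → π·L` as `ν ↓ 0` implies — via Loomis' converse of Fatou's theorem
(symmetric derivative of `σ` at `0` exists and equals `L`) and one integration by parts against the
symmetric distribution function — that EVERY even window kernel `K` with `K ∈ L¹`, `K` differentiable
and `x·K'(x) ∈ L¹` recovers the same value: `∫ τ·K(τω) dσ(ω) → L·∫K` as `τ → ∞`. The Abel kernel is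
`K = 1/(1+x²)`; compact-horizon time windows `ψ ∈ C³_c`, `ψ(0)=1`, `ψ'(0)=0` give admissible `K = Ψ_c`
(cosine transform), the Fejér/Helfand window `(1-s)₊` does not (`ψ'(0) ≠ 0`). -/
theorem loomis_window_upgrade (σ : Measure ℝ) [IsFiniteMeasure σ] (L : ℝ) (K : ℝ → ℝ)
    (hK_even : ∀ x, K (-x) = K x) (hK_diff : Differentiable ℝ K) (hK_int : Integrable K)
    (hK' : Integrable fun x => x * deriv K x)
    (hAbel : Tendsto (fun ν : ℝ => ∫ ω, ν / (ν ^ 2 + ω ^ 2) ∂σ) (𝓝[>] 0) (𝓝 (Real.pi * L))) :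
    Tendsto (fun τ : ℝ => ∫ ω, τ * K (τ * ω) ∂σ) atTop (𝓝 (L * ∫ x, K x)) := by
  sorry

/-- **Karamata / Hardy–Littlewood upgrade, Riesz window of order 2** (gen-2 sharpening of card
`loomis-compact-horizon-witness`; Feller II, XIII.5 Thm 2 with `ρ = 2`). For a bounded measurable
correlation function `C` whose doubly integrated form `V(t)/2 = ∫₀ᵗ (t-u) C(u) du` is NON-NEGATIVE (automatic
when `C` is positive-definite: `∫₀ᵗ(t-u)cos(ωu)du = (1 - cos ωt)/ω² ≥ 0`), the Abel hypothesis
`∫₀^∞ e^{-νt} C(t) dt → L` (`ν ↓ 0`) alone gives the compact-horizon Riesz mean of order two: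
`∫₀ᵗ (1 - u/t)² C(u) du → L` (`t → ∞`) — no Loomis step, no flat top (`ψ(s) = (1-s)²`, `ψ'(0) = -2`).
Proof route: `U(t) := ∫₀ᵗ V/2` is non-decreasing, its Laplace–Stieltjes transform is `ν⁻² ∫e^{-νt}C`, so
Karamata's Tauberian theorem (index 2) gives `U(t) ~ L t²/2`, and `U(t) = ½∫₀ᵗ(t-u)²C(u)du`. -/
theorem karamata_riesz_two_upgrade (C : ℝ → ℝ) (L M : ℝ) (hC_meas : Measurable C)
    (hC_bdd : ∀ t, |C t| ≤ M)
    (hV_nonneg : ∀ t : ℝ, 0 ≤ t → 0 ≤ ∫ u in Ioc (0 : ℝ) t, (t - u) * C u)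
    (hAbel : Tendsto (fun ν : ℝ => ∫ t in Ioi (0 : ℝ), Real.exp (-(ν * t)) * C t) (𝓝[>] 0) (𝓝 L)) :
    Tendsto (fun t : ℝ => ∫ u in Ioc (0 : ℝ) t, (1 - u / t) ^ 2 * C u) atTop (𝓝 L) := by
  sorry

/-- **Karamata with an ultimately monotone density ⇒ the Einstein–Helfand window** (Feller II, XIII.5
Thm 4, `ρ = 2`): if moreover `t ↦ ∫₀ᵗ (t-u) C(u) du` is eventually non-decreasing — i.e. the running
Green–Kubo integral `∫₀ᵗ C` of the CLOSED chain is eventually `≥ 0` ("the energy spread never shrinks") —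
then the Fejér/Helfand mean converges: `∫₀ᵗ (1 - u/t) C(u) du → L`, i.e. `Var(∫₀ᵗ J)/(2t·length) → L`. -/
theorem karamata_helfand_upgrade (C : ℝ → ℝ) (L M t₀ : ℝ) (hC_meas : Measurable C)
    (hC_bdd : ∀ t, |C t| ≤ M)
    (hV_mono : MonotoneOn (fun t : ℝ => ∫ u in Ioc (0 : ℝ) t, (t - u) * C u) (Ici t₀))
    (hV_nonneg : ∀ t : ℝ, 0 ≤ t → 0 ≤ ∫ u in Ioc (0 : ℝ) t, (t - u) * C u)
    (hAbel : Tendsto (fun ν : ℝ => ∫ t in Ioi (0 : ℝ), Real.exp (-(ν * t)) * C t) (𝓝[>] 0) (𝓝 L)) :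
    Tendsto (fun t : ℝ => ∫ u in Ioc (0 : ℝ) t, (1 - u / t) * C u) atTop (𝓝 L) := by
  sorry

/-- Chain-level form of the Riesz-2 upgrade over the crux's own vocabulary (the Bochner representation of
the positive-definite `currentCorrelation` is the infrastructure input that makes `V ≥ 0` automatic):
the Abelian Green–Kubo witness at `T` yields `T⁻² ∫₀ᵗ (1 - u/t)² C_T(u) du → κ`. -/
def RieszTwoWitnessOfAbel : Prop :=
  ∀ ω₂ lam β γ : ℝ, 0 < ω₂ → 0 < lam → 0 < β → 0 < γ → ∀ T : ℝ, 0 < T →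
    ∀ (μT : Measure ChainConfig) (D : InfiniteChainDynamics (pinnedChain ω₂ lam β γ)) (κ : ℝ),
      (pinnedChain ω₂ lam β γ).IsChainGibbsMeasure T μT → D.PreservesMeasure μT →
      (∀ t : ℝ, D.HasAbsConvergentCorrelation μT t) →
      (∃ σ : Measure ℝ, IsFiniteMeasure σ ∧
        ∀ t : ℝ, D.currentCorrelation μT t = ∫ ω, Real.cos (ω * t) ∂σ) →
      Tendsto (fun ν : ℝ => (T ^ 2)⁻¹ *
          ∫ t in Ioi (0 : ℝ), Real.exp (-(ν * t)) * D.currentCorrelation μT t) (𝓝[>] 0) (𝓝 κ) →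
      Tendsto (fun t : ℝ => (T ^ 2)⁻¹ * ∫ u in Ioc (0 : ℝ) t, (1 - u / t) ^ 2 * D.currentCorrelation μT u)
        atTop (𝓝 κ)

/-- Admissible compact-horizon time windows: `ψ ∈ C³`, supported in `[0,1]`, `ψ(0) = 1`, `ψ'(0) = 0`
(e.g. `ψ(s) = (1 - s²)⁴` on `[0,1]`). -/
def IsAdmissibleWindow (ψ : ℝ → ℝ) : Prop :=
  ContDiff ℝ 3 ψ ∧ (∀ s, 1 ≤ s → ψ s = 0) ∧ ψ 0 = 1 ∧ deriv ψ 0 = 0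

/-- **Compact-horizon Green–Kubo witness from the Abel witness** (chain-level shape of the upgrade,
stated over the crux's own vocabulary; the Bochner representation `C_T(t) = ∫ cos(ωt) dσ_T(ω)` of the
positive-definite correlation is the infrastructure input): if `T⁻²∫₀^∞ e^{-νt} C_T(t) dt → κ` as
`ν ↓ 0` then for every admissible window `ψ`, `T⁻² ∫₀^τ ψ(t/τ) C_T(t) dt → κ` as `τ → ∞` — a witness
that only ever looks at times `t ≤ τ`. -/
def CompactHorizonWitnessOfAbel : Prop :=
  ∀ ω₂ lam β γ : ℝ, 0 < ω₂ → 0 < lam → 0 < β → 0 < γ → ∀ T : ℝ, 0 < T →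
    ∀ (μT : Measure ChainConfig) (D : InfiniteChainDynamics (pinnedChain ω₂ lam β γ)) (κ : ℝ),
      (pinnedChain ω₂ lam β γ).IsChainGibbsMeasure T μT → D.PreservesMeasure μT →
      (∀ t : ℝ, D.HasAbsConvergentCorrelation μT t) →
      (∃ σ : Measure ℝ, IsFiniteMeasure σ ∧
        ∀ t : ℝ, D.currentCorrelation μT t = ∫ ω, Real.cos (ω * t) ∂σ) →
      Tendsto (fun ν : ℝ => (T ^ 2)⁻¹ *
          ∫ t in Ioi (0 : ℝ), Real.exp (-(ν * t)) * D.currentCorrelation μT t) (𝓝[>] 0) (𝓝 κ) →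
      ∀ ψ : ℝ → ℝ, IsAdmissibleWindow ψ →
        Tendsto (fun τ : ℝ => (T ^ 2)⁻¹ * ∫ t in Ioc (0 : ℝ) τ, ψ (t / τ) * D.currentCorrelation μT t)
          atTop (𝓝 κ)

/-- **Post-dark stability** — the single residual statement the crux reduces to once the witness is
compact-horizon and the open/closed matching inside the dark time `t ≤ N/v` is done by finite
propagation speed: the running per-bond Green–Kubo integral of the OPEN chain,
`R_N(t) := (N-1)⁻¹ ∫₀^t c_N(s) ds` (with `c_N` as in route StaticAbelianSqueeze / card
fekete-at-every-laplace-frequency), does not move after the dark time, in ψ-window average: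
`lim_N [ (N-1)⁻¹∫₀^∞ c_N − (N-1)⁻¹∫₀^{N/v} ψ(vt/N) c_N(t) dt ] = 0`. Stated over an abstract
autocorrelation family to fix the shape. -/
def PostDarkStability (c : ℕ → ℝ → ℝ) (v : ℝ) (ψ : ℝ → ℝ) : Prop :=
  Tendsto (fun N : ℕ => ((N : ℝ) - 1)⁻¹ * ∫ t in Ioi (0 : ℝ), c N t -
      ((N : ℝ) - 1)⁻¹ * ∫ t in Ioc (0 : ℝ) (N / v), ψ (v * t / N) * c N t) atTop (𝓝 0)

end Summit.AtomisticToContinuum.FouriersLaw.Cruxes.AbelThermodynamicLimit.LoomisCompactHorizonWitness
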